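import Mathlib
import Summits.CriticalPhenomena.PercolationContinuityZ3.Theorems.PercNearOneGluingNoHeavyLowerTailOrientedAntipodalHallTwoSidedCertificate

/-!
# Two-sided ordered certificates at label level: the table theorem

Helper file for crux `stmt-CriticalPhenomena-4575` (`NoHeavyLowerTail`, route `PercNearOneGluingNoHeavy`),
new-inequality factory seat `prim-ineq-gen-3` (gen 16).  Everything here is PROVED.  Continuation of
`…OrientedAntipodalHallTwoSidedCertificate` (the socket `card_le_card_goods_above_of_orderedTwoSided` and the label
calculus `mem_twoSided_or_cogood`); see that file's docstring for the setting.

**The label-level certificate (`card_le_card_goods_above_of_twoSidedCert`, SDR form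
`exists_injective_good_above_of_twoSidedCert`, table form `exists_injective_good_above_of_twoSidedTable`).**  Members
are PLAIN (`M X = X`) or COMPLEMENTED (`M X = S \ X`) per type (bit `pl`); the pseudo-sets are the TWO-SIDED
enlargement `Ψ_R = {E : f E = B, f (S \ E) = C_r, r ∈ R}` and `Φ_{S₀} = {F : f F = C_s, f (S \ F) = A, s ∈ S₀}` (each
disjoint from a bad of `D`); the order is by block ranks `rM` (types), `rΨ`, `rΦ` (pseudo-classes), refined inside a
block by non-increasing size.  The hypotheses `hMM`, `hMΨ`, `hMΦ` are decidable statements about labels saying that no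
element can lie inside a later one and that every forward difference is a certified co-good or a pseudo-set (plain
members may only precede plain members; a pseudo-set may precede anything not containing it).  Reach and instances:
`…OrientedAntipodalHallTwoSidedCertificateInstances` and memo FINDINGS-gen16.md (`run/shared/lean/prim/prim-ineq-gen-3/`).
(prim-ineq-gen-3 gen 16, 2026-08-22.)
-/

namespace Summit.CriticalPhenomena.PercolationContinuityZ3.Theorems

namespace OrientedAntipodalHall

open Finset AntipodalStrongHarris AntipodalStrongHarris.Lab OrderedDifferences
open scoped FinsetFamily

variable {α : Type*} [DecidableEq α] {k : ℕ}

section TwoSided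

variable (S : Finset α) {f : Finset α → Lab k} (D : Finset (Finset α)) (R S₀ : Finset (Fin k))

/-- **Two-sided ordered certificate, label level (counting form).**  `f` monotone, `D` an opposite-free family of
antipodal bads of `S`.  A certificate consists of: a bit `pl p q` per type (member `X` itself if `pl`, else `S \ X`;
the member then has set-label `C_{a X}` and complement-label `C_{b X}`), pseudo-classes `R` (sets `E` with `f E = B`,
`f (S \ E) = C_r`) and `S₀` (sets `F` with `f F = C_s`, `f (S \ F) = A`), and block ranks `rM` (types), `rΨ`, `rΦ`
(pseudo-classes).  The label conditions `hMM`, `hMΨ`, `hMΦ` state that, reading the blocks by increasing rank (ties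
and the inside of a block ordered by non-increasing size), no element can be contained in a later one and every
forward difference is a certified co-good or a pseudo-set of `Ψ_R ∪ Φ_{S₀}` (plain members may only precede plain
members; pseudo-sets precede anything they are not contained in).  Then at least `#D` good sets lie above members
of `D`. -/
theorem card_le_card_goods_above_of_twoSidedCert (hf : ∀ ⦃X Y : Finset α⦄, X ⊆ Y → f X ≤ f Y)
    (i j : Finset α → Fin k) (hDS : ∀ X ∈ D, X ⊆ S) (hDi : ∀ X ∈ D, f X = petal (i X))
    (hDj : ∀ X ∈ D, f (S \ X) = petal (j X)) (pl : Fin k → Fin k → Bool) (rM : Fin k → Fin k → ℕ)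
    (rΨ rΦ : Fin k → ℕ) (a b : Finset α → Fin k) (ha : ∀ X ∈ D, a X = if pl (i X) (j X) then i X else j X)
    (hb : ∀ X ∈ D, b X = if pl (i X) (j X) then j X else i X)
    (hOpp : ∀ X ∈ D, ∀ X' ∈ D, ¬ (i X = j X' ∧ j X = i X'))
    (hMM : ∀ X ∈ D, ∀ X' ∈ D,
      (rM (i X) (j X) ≤ rM (i X') (j X') →
        (pl (i X) (j X) = true → pl (i X') (j X') = true) ∧
        ((a X ≠ b X' ∧ b X ≠ a X') ∨ (a X ≠ b X' ∧ b X = a X' ∧ b X ∈ R) ∨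
          (a X = b X' ∧ b X ≠ a X' ∧ a X ∈ S₀))) ∧
      (rM (i X) (j X) < rM (i X') (j X') → ¬ (a X = a X' ∧ b X = b X')))
    (hMΨ : ∀ X ∈ D, ∀ r ∈ R,
      (rM (i X) (j X) ≤ rΨ r → pl (i X) (j X) = false ∧ a X ≠ r ∧ b X ∈ R) ∧
      (rΨ r < rM (i X) (j X) → r ≠ b X))
    (hMΦ : ∀ X ∈ D, ∀ s ∈ S₀,
      (rM (i X) (j X) ≤ rΦ s → pl (i X) (j X) = false ∧ b X ≠ s ∧ a X ∈ S₀) ∧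
      (rΦ s < rM (i X) (j X) → s ≠ a X)) :
    #D ≤ #{U ∈ S.powerset | f U = top ∧ f (S \ U) = bot ∧ ∃ X ∈ D, X ⊆ U} := by
  classical
  -- the members
  let M : Finset α → Finset α := fun X => if pl (i X) (j X) then X else S \ X
  have hMS : ∀ X ∈ D, M X ⊆ S := by
    intro X hX
    by_cases h : pl (i X) (j X) = true
    · simp only [M, h, if_true]; exact hDS X hX
    · simp only [M, h]; exact sdiff_subset
  have hMa : ∀ X ∈ D, f (M X) = petal (a X) := by
    intro X hX
    by_cases h : pl (i X) (j X) = true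
    · simp only [M, h, if_true, ha X hX]; exact hDi X hX
    · rw [ha X hX]; simp only [M, h, Bool.false_eq_true, if_false]; exact hDj X hX
  have hMb : ∀ X ∈ D, f (S \ M X) = petal (b X) := by
    intro X hX
    by_cases h : pl (i X) (j X) = true
    · simp only [M, h, if_true, hb X hX]; exact hDj X hX
    · rw [hb X hX]; simp only [M, h, Bool.false_eq_true, if_false]
      rw [Finset.sdiff_sdiff_eq_self (hDS X hX)]; exact hDi X hX
  have hij : ∀ X ∈ D, i X ≠ j X := fun X hX h => hOpp X hX X hX ⟨h, h.symm⟩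
  -- witness: `M X \ V` is disjoint from a bad of `D` (for plain members only if `V` is a plain member)
  have hMwit : ∀ X ∈ D, pl (i X) (j X) = false → ∀ V, ∃ Y ∈ D, Disjoint (M X \ V) Y := by
    intro X hX h V
    refine ⟨X, hX, ?_⟩
    simp only [M, h, Bool.false_eq_true, if_false]
    exact (disjoint_sdiff_self_left).mono_left sdiff_subset
  -- injectivity of `M` on `D` (opposite-freeness)
  have hMinj : ∀ X ∈ D, ∀ X' ∈ D, M X = M X' → X = X' := by
    intro X hX X' hX' hMM'
    by_cases h : pl (i X) (j X) = true <;> by_cases h' : pl (i X') (j X') = true <;>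
      simp only [M, h, h', if_true, Bool.false_eq_true, if_false] at hMM'
    · exact hMM'
    · exfalso
      have h1 : f X = f (S \ X') := by rw [hMM']
      have h2 : f (S \ X) = f X' := by rw [hMM', Finset.sdiff_sdiff_eq_self (hDS X' hX')]
      rw [hDi X hX, hDj X' hX'] at h1
      rw [hDj X hX, hDi X' hX'] at h2
      exact hOpp X hX X' hX' ⟨petal.inj h1, petal.inj h2⟩
    · exfalso
      have h1 : f (S \ X) = f X' := by rw [hMM']
      have h2 : f X = f (S \ X') := by rw [← hMM', Finset.sdiff_sdiff_eq_self (hDS X hX)]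
      rw [hDj X hX, hDi X' hX'] at h1
      rw [hDi X hX, hDj X' hX'] at h2
      exact hOpp X hX X' hX' ⟨petal.inj h2, petal.inj h1⟩
    · rw [← Finset.sdiff_sdiff_eq_self (hDS X hX), hMM', Finset.sdiff_sdiff_eq_self (hDS X' hX')]
  -- the pseudo-sets
  set P : Finset (Finset α) := {E ∈ S.powerset | (∃ Y ∈ D, Disjoint E Y) ∧
      ((f E = bot ∧ ∃ r ∈ R, f (S \ E) = petal r) ∨ (f (S \ E) = top ∧ ∃ s ∈ S₀, f E = petal s))} with hP
  let rB : Finset α → ℕ := fun E => match f E, f (S \ E) with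
    | bot, petal r => rΨ r
    | petal s, top => rΦ s
    | _, _ => 0
  have hPdesc : ∀ E ∈ P, E ⊆ S ∧ (∃ Y ∈ D, Disjoint E Y) ∧
      ((f E = bot ∧ ∃ r ∈ R, f (S \ E) = petal r ∧ rB E = rΨ r) ∨
       (f (S \ E) = top ∧ ∃ s ∈ S₀, f E = petal s ∧ rB E = rΦ s)) := by
    intro E hE
    rw [hP, mem_filter, mem_powerset] at hE
    obtain ⟨hES, hEY, hlab⟩ := hE
    refine ⟨hES, hEY, ?_⟩
    rcases hlab with ⟨hb, r, hr, hEr⟩ | ⟨ht, s, hs, hEs⟩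
    · exact Or.inl ⟨hb, r, hr, hEr, by simp [rB, hb, hEr]⟩
    · exact Or.inr ⟨ht, s, hs, hEs, by simp [rB, ht, hEs]⟩
  -- every difference `E \ V` of a pseudo-set is a pseudo-set or a certified co-good
  have hPgood : ∀ E ∈ P, ∀ V : Finset α,
      E \ V ∈ P ∨ (E \ V ⊆ S ∧ f (E \ V) = bot ∧ f (S \ (E \ V)) = top ∧ ∃ Y ∈ D, Disjoint (E \ V) Y) := by
    intro E hE V
    obtain ⟨hES, ⟨Y, hY, hEY⟩, hlab⟩ := hPdesc E hE
    have hZS : E \ V ⊆ S := sdiff_subset.trans hES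
    have hZY : ∃ Y ∈ D, Disjoint (E \ V) Y := ⟨Y, hY, hEY.mono_left sdiff_subset⟩
    have hle1 : f (E \ V) ≤ f E := hf sdiff_subset
    have hle2 : f (S \ E) ≤ f (S \ (E \ V)) := hf (sdiff_subset_sdiff le_rfl sdiff_subset)
    rcases hlab with ⟨hb, r, hr, hEr, -⟩ | ⟨ht, s, hs, hEs, -⟩
    · rw [hb] at hle1; rw [hEr] at hle2
      exact mem_twoSided_or_cogood S D R S₀ P hP hZS hZY (Or.inl (eq_bot_of_le_bot hle1))
        ((eq_or_eq_top_of_petal_le hle2).symm.imp id fun h => ⟨r, hr, h⟩) (Or.inl (eq_bot_of_le_bot hle1))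
    · rw [hEs] at hle1; rw [ht] at hle2
      exact mem_twoSided_or_cogood S D R S₀ P hP hZS hZY
        ((eq_bot_or_eq_of_le_petal hle1).imp id fun h => ⟨s, hs, h⟩) (Or.inl (eq_top_of_top_le hle2))
        (Or.inr (eq_top_of_top_le hle2))
  -- ranks: block rank, then non-increasing size
  let ρM : Finset α → ℕ ×ₗ ℕᵒᵈ := fun X => toLex (rM (i X) (j X), OrderDual.toDual #(M X))
  let ρP : Finset α → ℕ ×ₗ ℕᵒᵈ := fun E => toLex (rB E, OrderDual.toDual #E)
  refine card_le_card_goods_above_of_orderedTwoSided S hf D i j hDS hDi hDj hij M P ρM ρP ?_ ?_ ?_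
  · -- member / member
    intro X hX X' hX' hXX hle
    have hle' : rM (i X) (j X) < rM (i X') (j X') ∨
        (rM (i X) (j X) = rM (i X') (j X') ∧ #(M X') ≤ #(M X)) := by
      rcases Prod.Lex.le_iff.mp hle with h | ⟨h1, h2⟩
      · exact Or.inl h
      · exact Or.inr ⟨h1, OrderDual.toDual_le_toDual.mp h2⟩
    have hrle : rM (i X) (j X) ≤ rM (i X') (j X') := by
      rcases hle' with h | ⟨h, -⟩
      · exact h.le
      · exact h.le
    obtain ⟨hplain, hdiff⟩ := (hMM X hX X' hX').1 hrle
    refine ⟨?_, ?_⟩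
    · -- non-containment
      intro hsub
      rcases hle' with hlt | ⟨-, hcard⟩
      · have hne := (hMM X hX X' hX').2 hlt
        have h1 : f (M X) ≤ f (M X') := hf hsub
        have h2 : f (S \ M X') ≤ f (S \ M X) := hf (sdiff_subset_sdiff le_rfl hsub)
        rw [hMa X hX, hMa X' hX', petal_le_petal_iff] at h1
        rw [hMb X hX, hMb X' hX', petal_le_petal_iff] at h2
        exact hne ⟨h1, h2.symm⟩
      · exact hXX (hMinj X hX X' hX' (eq_of_subset_of_card_le hsub hcard))
    · -- the difference
      have hZS : M X \ M X' ⊆ S := sdiff_subset.trans (hMS X hX)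
      have hZY : ∃ Y ∈ D, Disjoint (M X \ M X') Y := by
        by_cases h : pl (i X) (j X) = true
        · have h' : pl (i X') (j X') = true := hplain h
          refine ⟨X', hX', ?_⟩
          simp only [M, h, h', if_true]
          exact disjoint_sdiff_self_left
        · exact hMwit X hX (by simpa using h) (M X')
      have hl1 : f (M X \ M X') ≤ petal (a X) := (hMa X hX) ▸ hf sdiff_subset
      have hl2 : f (M X \ M X') ≤ petal (b X') := by
        rw [← hMb X' hX']
        exact hf (fun x hx => mem_sdiff.mpr ⟨hZS hx, (mem_sdiff.mp hx).2⟩)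
      have hu1 : petal (b X) ≤ f (S \ (M X \ M X')) :=
        (hMb X hX) ▸ hf (sdiff_subset_sdiff le_rfl sdiff_subset)
      have hu2 : petal (a X') ≤ f (S \ (M X \ M X')) := by
        rw [← hMa X' hX']
        refine hf (fun x hx => mem_sdiff.mpr ⟨hMS X' hX' hx, fun h => (mem_sdiff.mp h).2 hx⟩)
      rcases hdiff with ⟨h1, h2⟩ | ⟨h1, h2, h3⟩ | ⟨h1, h2, h3⟩
      · exact mem_twoSided_or_cogood S D R S₀ P hP hZS hZY (Or.inl (eq_bot_of_le_petal h1 hl1 hl2))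
          (Or.inl (eq_top_of_petal_le h2 hu1 hu2)) (Or.inl (eq_bot_of_le_petal h1 hl1 hl2))
      · exact mem_twoSided_or_cogood S D R S₀ P hP hZS hZY (Or.inl (eq_bot_of_le_petal h1 hl1 hl2))
          ((eq_or_eq_top_of_petal_le hu1).symm.imp id fun h => ⟨b X, h3, h⟩)
          (Or.inl (eq_bot_of_le_petal h1 hl1 hl2))
      · exact mem_twoSided_or_cogood S D R S₀ P hP hZS hZY
          ((eq_bot_or_eq_of_le_petal hl1).imp id fun h => ⟨a X, h3, h⟩)
          (Or.inl (eq_top_of_petal_le h2 hu1 hu2)) (Or.inr (eq_top_of_petal_le h2 hu1 hu2))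
  · -- member / pseudo-set
    intro X hX E hE
    obtain ⟨hES, hEY, hlab⟩ := hPdesc E hE
    constructor
    · intro hle
      have hrle : rM (i X) (j X) ≤ rB E := by
        rcases Prod.Lex.le_iff.mp hle with h | ⟨h1, -⟩
        · exact h.le
        · exact h1.le
      rcases hlab with ⟨hb, r, hr, hEr, hrB⟩ | ⟨ht, s, hs, hEs, hrB⟩
      · -- `E ∈ Ψ_r`
        rw [hrB] at hrle
        obtain ⟨hpl, har, hbR⟩ := (hMΨ X hX r hr).1 hrle
        refine ⟨fun hsub => ?_, ?_⟩
        · have h1 : f (M X) ≤ f E := hf hsub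
          rw [hMa X hX, hb, le_def] at h1
          rcases h1 with h | h | h <;> simp at h
        · have hZS : M X \ E ⊆ S := sdiff_subset.trans (hMS X hX)
          have hl : f (M X \ E) = bot := by
            refine eq_bot_of_le_petal har ((hMa X hX) ▸ hf sdiff_subset) ?_
            rw [← hEr]
            exact hf (fun x hx => mem_sdiff.mpr ⟨hZS hx, (mem_sdiff.mp hx).2⟩)
          have hu : petal (b X) ≤ f (S \ (M X \ E)) := (hMb X hX) ▸ hf (sdiff_subset_sdiff le_rfl sdiff_subset)
          exact mem_twoSided_or_cogood S D R S₀ P hP hZS (hMwit X hX hpl E) (Or.inl hl)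
            ((eq_or_eq_top_of_petal_le hu).symm.imp id fun h => ⟨b X, hbR, h⟩) (Or.inl hl)
      · -- `E ∈ Φ_s`
        rw [hrB] at hrle
        obtain ⟨hpl, hbs, haS⟩ := (hMΦ X hX s hs).1 hrle
        refine ⟨fun hsub => ?_, ?_⟩
        · have h1 : f (S \ E) ≤ f (S \ M X) := hf (sdiff_subset_sdiff le_rfl hsub)
          rw [hMb X hX, ht] at h1
          exact absurd (eq_top_of_top_le h1) (by simp)
        · have hZS : M X \ E ⊆ S := sdiff_subset.trans (hMS X hX)
          have hl : f (M X \ E) ≤ petal (a X) := (hMa X hX) ▸ hf sdiff_subset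
          have hu : f (S \ (M X \ E)) = top := by
            refine eq_top_of_petal_le hbs ((hMb X hX) ▸ hf (sdiff_subset_sdiff le_rfl sdiff_subset)) ?_
            rw [← hEs]
            exact hf (fun x hx => mem_sdiff.mpr ⟨hES hx, fun h => (mem_sdiff.mp h).2 hx⟩)
          exact mem_twoSided_or_cogood S D R S₀ P hP hZS (hMwit X hX hpl E)
            ((eq_bot_or_eq_of_le_petal hl).imp id fun h => ⟨a X, haS, h⟩) (Or.inl hu) (Or.inr hu)
    · intro hle
      have hle' : rB E < rM (i X) (j X) ∨ (rB E = rM (i X) (j X) ∧ #(M X) ≤ #E) := by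
        rcases Prod.Lex.le_iff.mp hle with h | ⟨h1, h2⟩
        · exact Or.inl h
        · exact Or.inr ⟨h1, OrderDual.toDual_le_toDual.mp h2⟩
      refine ⟨fun hsub => ?_, hPgood E hE (M X)⟩
      rcases hle' with hlt | ⟨-, hcard⟩
      · rcases hlab with ⟨hb, r, hr, hEr, hrB⟩ | ⟨ht, s, hs, hEs, hrB⟩
        · rw [hrB] at hlt
          have hne := (hMΨ X hX r hr).2 hlt
          have h1 : f (S \ M X) ≤ f (S \ E) := hf (sdiff_subset_sdiff le_rfl hsub)
          rw [hMb X hX, hEr, petal_le_petal_iff] at h1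
          exact hne h1.symm
        · rw [hrB] at hlt
          have hne := (hMΦ X hX s hs).2 hlt
          have h1 : f E ≤ f (M X) := hf hsub
          rw [hMa X hX, hEs, petal_le_petal_iff] at h1
          exact hne h1
      · have heq : E = M X := eq_of_subset_of_card_le hsub hcard
        rcases hlab with ⟨hb, -⟩ | ⟨ht, -⟩
        · rw [heq, hMa X hX] at hb; exact absurd hb (by simp)
        · rw [heq, hMb X hX] at ht; exact absurd ht (by simp)
  · -- pseudo-set / pseudo-set
    intro E hE E' hE' hEE hle
    obtain ⟨hES, hEY, hlab⟩ := hPdesc E hE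
    obtain ⟨hE'S, -, hlab'⟩ := hPdesc E' hE'
    have hle' : rB E < rB E' ∨ (rB E = rB E' ∧ #E' ≤ #E) := by
      rcases Prod.Lex.le_iff.mp hle with h | ⟨h1, h2⟩
      · exact Or.inl h
      · exact Or.inr ⟨h1, OrderDual.toDual_le_toDual.mp h2⟩
    refine ⟨fun hsub => ?_, hPgood E hE E'⟩
    rcases hle' with hlt | ⟨-, hcard⟩
    · have h1 : f E ≤ f E' := hf hsub
      have h2 : f (S \ E') ≤ f (S \ E) := hf (sdiff_subset_sdiff le_rfl hsub)
      rcases hlab with ⟨hb, r, hr, hEr, hrB⟩ | ⟨ht, s, hs, hEs, hrB⟩ <;>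
        rcases hlab' with ⟨hb', r', hr', hEr', hrB'⟩ | ⟨ht', s', hs', hEs', hrB'⟩
      · rw [hEr, hEr', petal_le_petal_iff] at h2
        rw [hrB, hrB', h2] at hlt
        exact lt_irrefl _ hlt
      · rw [ht', hEr] at h2
        exact absurd (eq_top_of_top_le h2) (by simp)
      · rw [hEs, hb'] at h1
        exact absurd (eq_bot_of_le_bot h1) (by simp)
      · rw [hEs, hEs', petal_le_petal_iff] at h1
        rw [hrB, hrB', h1] at hlt
        exact lt_irrefl _ hlt
    · exact hEE (eq_of_subset_of_card_le hsub hcard)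


/-- **Two-sided ordered certificate, label level (SDR form).**  Under the hypotheses of
`card_le_card_goods_above_of_twoSidedCert` the members of `D` have DISTINCT good representatives above them. -/
theorem exists_injective_good_above_of_twoSidedCert (hf : ∀ ⦃X Y : Finset α⦄, X ⊆ Y → f X ≤ f Y)
    (i j : Finset α → Fin k) (hDS : ∀ X ∈ D, X ⊆ S) (hDi : ∀ X ∈ D, f X = petal (i X))
    (hDj : ∀ X ∈ D, f (S \ X) = petal (j X)) (pl : Fin k → Fin k → Bool) (rM : Fin k → Fin k → ℕ)
    (rΨ rΦ : Fin k → ℕ) (a b : Finset α → Fin k) (ha : ∀ X ∈ D, a X = if pl (i X) (j X) then i X else j X)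
    (hb : ∀ X ∈ D, b X = if pl (i X) (j X) then j X else i X)
    (hOpp : ∀ X ∈ D, ∀ X' ∈ D, ¬ (i X = j X' ∧ j X = i X'))
    (hMM : ∀ X ∈ D, ∀ X' ∈ D,
      (rM (i X) (j X) ≤ rM (i X') (j X') →
        (pl (i X) (j X) = true → pl (i X') (j X') = true) ∧
        ((a X ≠ b X' ∧ b X ≠ a X') ∨ (a X ≠ b X' ∧ b X = a X' ∧ b X ∈ R) ∨
          (a X = b X' ∧ b X ≠ a X' ∧ a X ∈ S₀))) ∧
      (rM (i X) (j X) < rM (i X') (j X') → ¬ (a X = a X' ∧ b X = b X')))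
    (hMΨ : ∀ X ∈ D, ∀ r ∈ R,
      (rM (i X) (j X) ≤ rΨ r → pl (i X) (j X) = false ∧ a X ≠ r ∧ b X ∈ R) ∧
      (rΨ r < rM (i X) (j X) → r ≠ b X))
    (hMΦ : ∀ X ∈ D, ∀ s ∈ S₀,
      (rM (i X) (j X) ≤ rΦ s → pl (i X) (j X) = false ∧ b X ≠ s ∧ a X ∈ S₀) ∧
      (rΦ s < rM (i X) (j X) → s ≠ a X)) :
    ∃ φ : D → Finset α, Function.Injective φ ∧
      ∀ X : D, (X : Finset α) ⊆ φ X ∧ φ X ⊆ S ∧ f (φ X) = top ∧ f (S \ φ X) = bot := by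
  classical
  let t : D → Finset (Finset α) := fun X =>
    {U ∈ S.powerset | f U = top ∧ f (S \ U) = bot ∧ (X : Finset α) ⊆ U}
  have hHall : ∀ s : Finset D, #s ≤ #(s.biUnion t) := by
    intro s
    set D' : Finset (Finset α) := s.map (Function.Embedding.subtype _) with hD'
    have hD'sub : ∀ X ∈ D', X ∈ D := by
      intro X hX
      obtain ⟨x, -, rfl⟩ := mem_map.mp hX
      exact x.2
    have hcard : #s = #D' := (card_map _).symm
    have hle := card_le_card_goods_above_of_twoSidedCert S D' R S₀ hf i j (fun X hX => hDS X (hD'sub X hX))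
      (fun X hX => hDi X (hD'sub X hX)) (fun X hX => hDj X (hD'sub X hX)) pl rM rΨ rΦ a b
      (fun X hX => ha X (hD'sub X hX)) (fun X hX => hb X (hD'sub X hX))
      (fun X hX X' hX' => hOpp X (hD'sub X hX) X' (hD'sub X' hX'))
      (fun X hX X' hX' => hMM X (hD'sub X hX) X' (hD'sub X' hX'))
      (fun X hX r hr => hMΨ X (hD'sub X hX) r hr) (fun X hX s hs => hMΦ X (hD'sub X hX) s hs)
    have hgoods : {U ∈ S.powerset | f U = top ∧ f (S \ U) = bot ∧ ∃ X ∈ D', X ⊆ U} ⊆ s.biUnion t := by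
      intro U hU
      rw [mem_filter, mem_powerset] at hU
      obtain ⟨hUS, hUtop, hUbot, X, hX, hXU⟩ := hU
      obtain ⟨x, hx, rfl⟩ := mem_map.mp hX
      rw [mem_biUnion]
      refine ⟨x, hx, ?_⟩
      simp only [t, mem_filter, mem_powerset]
      exact ⟨hUS, hUtop, hUbot, hXU⟩
    calc #s = #D' := hcard
      _ ≤ #{U ∈ S.powerset | f U = top ∧ f (S \ U) = bot ∧ ∃ X ∈ D', X ⊆ U} := hle
      _ ≤ #(s.biUnion t) := card_le_card hgoods
  obtain ⟨φ, hφinj, hφ⟩ := (all_card_le_biUnion_card_iff_exists_injective t).mp hHall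
  refine ⟨φ, hφinj, fun X => ?_⟩
  have hX := hφ X
  simp only [t, mem_filter, mem_powerset] at hX
  exact ⟨hX.2.2.2, hX.1, hX.2.1, hX.2.2.1⟩

end TwoSided

/-- **Table form.**  If the types of `D` lie in a finite set `T` of ordered petal pairs for which the two-sided
certificate conditions have been checked ONCE on labels (`hcert`, decidable — `by decide` for a concrete table), the
members of `D` have distinct good representatives.  In `hcert` the set-label / complement-label index of a type
`t = (p,q)` is `(p,q)` if `pl p q` (plain member) and `(q,p)` otherwise (complemented member). -/
theorem exists_injective_good_above_of_twoSidedTable (T : Finset (Fin k × Fin k)) (pl : Fin k → Fin k → Bool)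
    (R S₀ : Finset (Fin k)) (rM : Fin k → Fin k → ℕ) (rΨ rΦ : Fin k → ℕ)
    (hcert : (∀ t ∈ T, ∀ t' ∈ T, ¬ (t.1 = t'.2 ∧ t.2 = t'.1) ∧
        (rM t.1 t.2 ≤ rM t'.1 t'.2 →
          (pl t.1 t.2 = true → pl t'.1 t'.2 = true) ∧
          (((if pl t.1 t.2 then t.1 else t.2) ≠ (if pl t'.1 t'.2 then t'.2 else t'.1) ∧
              (if pl t.1 t.2 then t.2 else t.1) ≠ (if pl t'.1 t'.2 then t'.1 else t'.2)) ∨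
            ((if pl t.1 t.2 then t.1 else t.2) ≠ (if pl t'.1 t'.2 then t'.2 else t'.1) ∧
              (if pl t.1 t.2 then t.2 else t.1) = (if pl t'.1 t'.2 then t'.1 else t'.2) ∧
              (if pl t.1 t.2 then t.2 else t.1) ∈ R) ∨
            ((if pl t.1 t.2 then t.1 else t.2) = (if pl t'.1 t'.2 then t'.2 else t'.1) ∧
              (if pl t.1 t.2 then t.2 else t.1) ≠ (if pl t'.1 t'.2 then t'.1 else t'.2) ∧
              (if pl t.1 t.2 then t.1 else t.2) ∈ S₀))) ∧
        (rM t.1 t.2 < rM t'.1 t'.2 →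
          ¬ ((if pl t.1 t.2 then t.1 else t.2) = (if pl t'.1 t'.2 then t'.1 else t'.2) ∧
             (if pl t.1 t.2 then t.2 else t.1) = (if pl t'.1 t'.2 then t'.2 else t'.1)))) ∧
      (∀ t ∈ T, ∀ r ∈ R,
        (rM t.1 t.2 ≤ rΨ r → pl t.1 t.2 = false ∧ (if pl t.1 t.2 then t.1 else t.2) ≠ r ∧
          (if pl t.1 t.2 then t.2 else t.1) ∈ R) ∧
        (rΨ r < rM t.1 t.2 → r ≠ (if pl t.1 t.2 then t.2 else t.1))) ∧
      (∀ t ∈ T, ∀ s ∈ S₀,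
        (rM t.1 t.2 ≤ rΦ s → pl t.1 t.2 = false ∧ (if pl t.1 t.2 then t.2 else t.1) ≠ s ∧
          (if pl t.1 t.2 then t.1 else t.2) ∈ S₀) ∧
        (rΦ s < rM t.1 t.2 → s ≠ (if pl t.1 t.2 then t.1 else t.2))))
    (S : Finset α) {f : Finset α → Lab k} (hf : ∀ ⦃X Y : Finset α⦄, X ⊆ Y → f X ≤ f Y)
    (D : Finset (Finset α)) (i j : Finset α → Fin k) (hDS : ∀ X ∈ D, X ⊆ S)
    (hDi : ∀ X ∈ D, f X = petal (i X)) (hDj : ∀ X ∈ D, f (S \ X) = petal (j X))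
    (hT : ∀ X ∈ D, (i X, j X) ∈ T) :
    ∃ φ : D → Finset α, Function.Injective φ ∧
      ∀ X : D, (X : Finset α) ⊆ φ X ∧ φ X ⊆ S ∧ f (φ X) = top ∧ f (S \ φ X) = bot :=
  exists_injective_good_above_of_twoSidedCert S D R S₀ hf i j hDS hDi hDj pl rM rΨ rΦ
    (fun X => if pl (i X) (j X) then i X else j X) (fun X => if pl (i X) (j X) then j X else i X)
    (fun _ _ => rfl) (fun _ _ => rfl)
    (fun X hX X' hX' => (hcert.1 (i X, j X) (hT X hX) (i X', j X') (hT X' hX')).1)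
    (fun X hX X' hX' => (hcert.1 (i X, j X) (hT X hX) (i X', j X') (hT X' hX')).2)
    (fun X hX r hr => hcert.2.1 (i X, j X) (hT X hX) r hr) (fun X hX s hs => hcert.2.2 (i X, j X) (hT X hX) s hs)

end OrientedAntipodalHall

end Summit.CriticalPhenomena.PercolationContinuityZ3.Theorems
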